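import Literature.MathematicalPhysics.QuantumFieldTheory.Balaban1983to89.B13Bound226Assembly
import Literature.MathematicalPhysics.QuantumFieldTheory.Balaban1983to89.B13Eq216LatticeSum

/-!
# `Balaban1983to89.B13Bound226From216` — T. Bałaban, *Renormalization group approach to lattice gauge field theories.
II. Cluster expansions*, Commun. Math. Phys. **116** (1988) 1–22 [Balaban1988RG2Cluster], pp. 15–17: the bound (2.26)
of the generic term (2.14) assembled end to end (`B13Bound226Assembly`) with the replacement errors entered in the
PRINTED ENTRYWISE SHAPE (2.16) — `|R(b,b′)| ≤ θ·exp(−κ|b₋ − b′₋|)` for kernels indexed by bonds located on the unit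
lattice — instead of the derived (2.21)/(2.17) shapes: the step «(2.16) ⇒ (2.21), (2.17)» (*"The other quadratic forms,
i.e. the forms R₁, R₂, R₃, can be bounded in a similar way using (2.16), by the forms (2.21)"*; *"The determinants … are
equal for the new operators, hence this factor can be estimated by (2.17)"*) is performed here by the Schur / Leibniz
row-sum mechanisms of `B13PerturbativeStep` / `B13Replacement223` §6 and the lattice constant of `B13Eq216LatticeSum`
(Σ_{b′} e^{−κ|b₋−b′₋|} ≤ m(1 + 2/κ)^ν when at most m bonds sit at a site of ℤ^ν).

statement-level skeleton of published theorems with citation tags; proofs where landed; nothing here is a claim about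
the Yang–Mills mass gap

PDF held: `paper:balaban1988-cmp116-rg-ii-cluster` (journal page = PDF page + 0); pp. 15–17 re-read this session from the
materialised text `p0015.txt`–`p0017.txt` and the cell transcript `pub-balaban/b2b-balaban-b13/transcript-B13.md`
ll. 144–165 (locus L16a: (2.16)/(2.17) are BY ASSERTION in print).

CITATION HEADER (verbatim, p. 16 [PDF 16]): *"For the quadratic form in the first exponential the difference is a
quadratic form ½⟨X, R₁X⟩, with matrix elements satisfying the bound*
`|R₁(b, b′)| ≦ (O(1)e^{−⅓δ₀M} + O(α₀ + α₁)) exp(−½δ₀|b₋ − b′₋|).`  (2.16)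
*… The determinants in the next factor are equal for the new operators, hence this factor can be estimated by*
`exp((O(1)e^{−⅓δ₀M} + O(α₀ + α₁))|Z₀|).`  (2.17)  *Similarly, the next Gaussian measure is replaced by the measure with
the new covariance, multiplied by a quotient of determinants, which can be estimated by (2.17), and by the function
exp½⟨B, R₂B⟩ with R₂ satisfying (2.16). In the second exponential the difference between the new bilinear form and the
form in (2.15) is a bilinear from ⟦sic⟧ −⟨B, R₃X⟩ with R₃ satisfying (2.16). … The other quadratic forms, i.e. the forms
R₁, R₂, R₃, can be bounded in a similar way using (2.16), by the forms* `½(O(1)e^{−⅓δ₀M} + O(α₀ + α₁))(‖ZX‖² + ‖Z₀B‖²)`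
(2.21)"; p. 17: *"This ends the estimate of the expression (2.14). Gathering together all the bounds we get"* (2.26).

WHAT IS REPRODUCED (unit `lit-balaban-r10` gen 11, B13 fold owner; SKELETON rows `B13.Eq2.16`, `B13.Eq2.17`,
`B13.Eq2.21`, `B13.Eq2.26`, `B13.Eq2.15` of `HOME/lit-balaban-r10/ROWS-B13.md`, HOME = `run/shared/lean/pub/lit-balaban/`;
the gen-10 HANDOFF item «end-to-end corollary taking (2.16) entrywise»).  Index sets are abstract finite types LOCATED on
ℤ^ν by maps `loc` with at most `m` indices per site (for the bonds of the unit lattice indexed by (b₋, direction),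
`m = ν`: `B13Eq216LatticeSum.card_fiber_bond_le`); the distance is `|loc b − loc b′|₁` (`B2Lemma25Proof.l1dist`).
* §1 `sum_exp_neg_l1dist_loc_le_pt`, `rowSum_norm_le_of_entrywise`, `colSum_norm_le_of_entrywise` — the lattice
  constant for RECTANGULAR located kernels (`R₃`: bonds of `Z₀` × bonds of `Z`): absolute row and column sums
  `≤ θ·m·(1 + 2/κ)^ν`.
* §2 the five hypotheses of `B13Bound226Assembly.norm_core214_F214_le_K` FROM THE ENTRYWISE (2.16), one `σ` at a time:
  `hR1_of_entrywise` ((2.21) for `R₁`), `hR2_of_entrywise` (for `R₂ = C⁻¹ − Re A = −Re E`, `E := A − C⁻¹` the difference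
  of the analytically continued precision and its `σ = 0`, `(U, 0)` value), `hR3_of_entrywise` (rectangular `R₃`),
  `h17a_of_entrywise` / `h17b_of_entrywise` ((2.17): the two determinant factors `≤ exp(η|Λ|)`,
  `η = ½K′θ′(1 + (1 − K′θ′)⁻¹)`, `θ′ = θ·m(1+2/κ)^ν`, `K′ = K₀·m(1+2/κ_C)^ν` from an entrywise decay
  `|C(b,b′)| ≤ K₀e^{−κ_C|b₋−b′₋|}` of the new covariance `C = C^{(k)}(Z₀, 0)` — the [15] propagator bound, locus L17a).
* §3 **`norm_core214_F214_le_K_of_216`** (the sup bound `K` of the last three lines of (2.14) on the parameter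
  polydiscs), **`norm_term214_le_226_of_216`** ((2.26) assembled), **`norm_term214_le_226_of_216_218`** (with the
  printed bracket at the τ-radii (2.18)) and **`norm_core214_F214_le_window_shape_of_216`** (the shape consumed by the
  window/torus joiner `B13Lemma3WindowCauchy.h226_of_cauchy`) — `B13Bound226Assembly` §1–§4 with `hR1`, `hR2`, `hR3`,
  `h17a`, `h17b` REPLACED by: (2.16) entrywise, uniformly for the `σ` of the σ-polydisc, for `R₁(σ)`, `E(σ) = A(σ) − C⁻¹`,
  `R₃(σ)`; the entrywise decay of `C`; and the smallness `K′θ′ < 1` (print: *"We have assumed … that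
  e^{−⅓δ₀M}e^{16κ₁} < 1"*, R11).  The printed constant of (2.21)/(2.17), «O(1)e^{−⅓δ₀M} + O(α₀ + α₁)», is `θ′`
  resp. `η`: the `θ` of (2.16) times the lattice O(1).
HONEST SCOPE.  Knitting only: after this file the chain (2.14) → (2.26) for the typed generic term
(`B13Term214.term214 … (core214 A Γ (F214 …))`) has as by-assertion inputs exactly the CROSS-PAPER leaves — the
entrywise (2.16) for the three kernels of the analytically continued operators (L16a; its Cauchy mechanism is
`B13PerturbativeStep.WRS.sub_apply_zero_of_differentiableOn`), the entrywise decay and the norms `c`, `g` of the [13]/[15]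
operators (L17a), (2.20) and (2.22) in their printed shapes (rows B13.Eq2.20 / 2.22, proved for the lattice objects in
`B13Resum220.ineq220` / `B13.indicator_le_exp_222`), and separate analyticity in (σ, τ).  No `sorry`, no definition, no
new named fact (D-0026).
-/

noncomputable section

namespace Literature.MathematicalPhysics.QuantumFieldTheory.Balaban1983to89.B13Bound226From216

open Complex MeasureTheory Metric Finset Matrix
open B2Lemma25Proof (l1dist l1dist_nonneg l1dist_comm sum_exp_neg_l1dist_le)
open B13PerturbativeStep (WRS WeightHyp)
open B13Eq216LatticeSum (weightHyp_l1dist)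
open B13Term214 (SepHolOn term214 core214 F214)
open B13Replacement223 (hR1_of_WRS hR2_of_WRS hR3_of_rowSum h17a_of_WRS h17b_of_WRS)
open B13Bound226Assembly (norm_core214_F214_le_K K_le_window_shape)
open B13CauchyDecay (norm_term214_le_215 norm_term214_le_226)
open B13Bound143 (invTau)

/-! ## §1. The lattice constant for rectangular located kernels -/

section Lattice

variable {ν : ℕ} {n p : Type*} [Fintype n] {𝕜 : Type*} [RCLike 𝕜]

/-- **The lattice constant from an arbitrary base point.**  If `loc : n → ℤ^ν` places at most `m` indices at each
site, then for every `x ∈ ℤ^ν` and rate `b > 0`, `Σ_j e^{−b|x − loc j|₁} ≤ m·(1 + 2/b)^ν` (group by sites, then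
`B2Lemma25Proof.sum_exp_neg_l1dist_le`) — the printed *"this yields a constant O(1)"* for a kernel whose row index lives
on another index set (the rectangular `R₃`). [cite: Balaban1988RG2Cluster, (2.16) p.16 and p.16 after (2.19)] -/
theorem sum_exp_neg_l1dist_loc_le_pt {b : ℝ} (hb : 0 < b) (loc : n → (Fin ν → ℤ)) {m : ℕ}
    (hfib : ∀ x : Fin ν → ℤ, (Finset.univ.filter fun j => loc j = x).card ≤ m) (x : Fin ν → ℤ) :
    ∑ j, Real.exp (-(b * l1dist x (loc j))) ≤ m * (1 + 2 / b) ^ ν := by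
  classical
  have hfw := Finset.sum_fiberwise_of_maps_to (s := (Finset.univ : Finset n)) (t := Finset.univ.image loc)
    (g := loc) (fun j hj => Finset.mem_image_of_mem loc hj) (fun j => Real.exp (-(b * l1dist x (loc j))))
  rw [← hfw]
  calc ∑ y ∈ Finset.univ.image loc, ∑ j ∈ Finset.univ.filter (fun j => loc j = y),
        Real.exp (-(b * l1dist x (loc j)))
      = ∑ y ∈ Finset.univ.image loc,
          ((Finset.univ.filter fun j => loc j = y).card : ℝ) * Real.exp (-(b * l1dist x y)) := by
        refine Finset.sum_congr rfl fun y _ => ?_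
        have hc : ∀ j ∈ Finset.univ.filter (fun j => loc j = y),
            Real.exp (-(b * l1dist x (loc j))) = Real.exp (-(b * l1dist x y)) := fun j hj => by
          rw [(Finset.mem_filter.1 hj).2]
        rw [Finset.sum_congr rfl hc, Finset.sum_const, nsmul_eq_mul]
    _ ≤ ∑ y ∈ Finset.univ.image loc, (m : ℝ) * Real.exp (-(b * l1dist x y)) :=
        Finset.sum_le_sum fun y _ => mul_le_mul_of_nonneg_right (by exact_mod_cast hfib y) (Real.exp_pos _).le
    _ = m * ∑ y ∈ Finset.univ.image loc, Real.exp (-(b * l1dist x y)) := by rw [Finset.mul_sum]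
    _ ≤ m * (1 + 2 / b) ^ ν :=
        mul_le_mul_of_nonneg_left (sum_exp_neg_l1dist_le hb x _) (Nat.cast_nonneg m)

/-- **Absolute row sums of a located rectangular kernel with entrywise decay** (`R₃`, bonds of `Z₀` × bonds of `Z`):
`‖R i j‖ ≤ θe^{−κ|loc′ i − loc j|₁}`, `κ > 0`, at most `m` column indices per site ⇒ `Σ_j ‖R i j‖ ≤ θ·m·(1 + 2/κ)^ν`.
[cite: Balaban1988RG2Cluster, (2.16) p.16, (2.21) p.16] -/
theorem rowSum_norm_le_of_entrywise {R : Matrix p n 𝕜} {θ κ : ℝ} (hθ : 0 ≤ θ) (hκ : 0 < κ)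
    (locp : p → (Fin ν → ℤ)) (locn : n → (Fin ν → ℤ)) {m : ℕ}
    (hfib : ∀ x : Fin ν → ℤ, (Finset.univ.filter fun j => locn j = x).card ≤ m)
    (hR : ∀ i j, ‖R i j‖ ≤ θ * Real.exp (-(κ * l1dist (locp i) (locn j)))) (i : p) :
    ∑ j, ‖R i j‖ ≤ θ * (m * (1 + 2 / κ) ^ ν) :=
  calc ∑ j, ‖R i j‖ ≤ ∑ j, θ * Real.exp (-(κ * l1dist (locp i) (locn j))) := Finset.sum_le_sum fun j _ => hR i j
    _ = θ * ∑ j, Real.exp (-(κ * l1dist (locp i) (locn j))) := by rw [Finset.mul_sum]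
    _ ≤ θ * (m * (1 + 2 / κ) ^ ν) :=
        mul_le_mul_of_nonneg_left (sum_exp_neg_l1dist_loc_le_pt hκ locn hfib (locp i)) hθ

omit [Fintype n] in
/-- **Absolute column sums of a located rectangular kernel with entrywise decay**: `‖R i j‖ ≤ θe^{−κ|loc′ i − loc j|₁}`,
`κ > 0`, at most `m` ROW indices per site ⇒ `Σ_i ‖R i j‖ ≤ θ·m·(1 + 2/κ)^ν` (the printed weight is symmetric in
b, b′). [cite: Balaban1988RG2Cluster, (2.16) p.16, (2.21) p.16] -/
theorem colSum_norm_le_of_entrywise [Fintype p] {R : Matrix p n 𝕜} {θ κ : ℝ} (hθ : 0 ≤ θ) (hκ : 0 < κ)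
    (locp : p → (Fin ν → ℤ)) (locn : n → (Fin ν → ℤ)) {m : ℕ}
    (hfib : ∀ x : Fin ν → ℤ, (Finset.univ.filter fun i => locp i = x).card ≤ m)
    (hR : ∀ i j, ‖R i j‖ ≤ θ * Real.exp (-(κ * l1dist (locp i) (locn j)))) (j : n) :
    ∑ i, ‖R i j‖ ≤ θ * (m * (1 + 2 / κ) ^ ν) :=
  calc ∑ i, ‖R i j‖ ≤ ∑ i, θ * Real.exp (-(κ * l1dist (locn j) (locp i))) :=
        Finset.sum_le_sum fun i _ => by rw [l1dist_comm]; exact hR i j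
    _ = θ * ∑ i, Real.exp (-(κ * l1dist (locn j) (locp i))) := by rw [Finset.mul_sum]
    _ ≤ θ * (m * (1 + 2 / κ) ^ ν) :=
        mul_le_mul_of_nonneg_left (sum_exp_neg_l1dist_loc_le_pt hκ locp hfib (locn j)) hθ

/-- **Entrywise decay ⇒ plain absolute row sums `≤ θ·m(1+2/κ)^ν` for `A` and `Aᵀ`** — the typed row-sum form
`B13PerturbativeStep.WRS` at rate `0` (weights `e^{0·d} = 1`), which is all the Schur bound (2.21) and the Leibniz
bound (2.17) consume (`B13Eq216LatticeSum.WRS.of_entrywise_loc` / `_transpose` at `κ′ = 0`).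
[cite: Balaban1988RG2Cluster, (2.16) p.16 and p.16 after (2.19)] -/
theorem WRS_zero_of_entrywise {A : Matrix n n 𝕜} {θ κ : ℝ} (hθ : 0 ≤ θ) (hκ : 0 < κ)
    (loc : n → (Fin ν → ℤ)) {m : ℕ} (hfib : ∀ x : Fin ν → ℤ, (Finset.univ.filter fun j => loc j = x).card ≤ m)
    (hA : ∀ i j, ‖A i j‖ ≤ θ * Real.exp (-(κ * l1dist (loc i) (loc j)))) :
    WRS 0 (fun i j => l1dist (loc i) (loc j)) A (θ * (m * (1 + 2 / κ) ^ ν)) ∧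
      WRS 0 (fun i j => l1dist (loc i) (loc j)) Aᵀ (θ * (m * (1 + 2 / κ) ^ ν)) := by
  have h1 := B13Eq216LatticeSum.WRS.of_entrywise_loc hθ hκ loc hfib hA
  have h2 := B13Eq216LatticeSum.WRS.of_entrywise_loc_transpose hθ hκ loc hfib hA
  rw [sub_zero] at h1 h2
  exact ⟨h1, h2⟩

end Lattice

/-! ## §2. The hypotheses `hR1`, `hR2`, `hR3`, `h17a`, `h17b` from the entrywise (2.16) -/

section From216

variable {ν : ℕ} {Λ N : Type} [Fintype Λ] [Fintype N] [DecidableEq Λ] [DecidableEq N]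
variable {A : Matrix Λ Λ ℂ} {C : Matrix Λ Λ ℝ}

omit [DecidableEq N] in
/-- **`hR1` from (2.16) for `R₁`** (*"For the quadratic form in the first exponential the difference is a quadratic form
½⟨X, R₁X⟩, with matrix elements satisfying the bound (2.16)"*): if `Re⟨Γ_σX, A⁻¹Γ_σX⟩ = ⟨Γ₀X, CΓ₀X⟩ − ⟨X, R₁X⟩` with
`|R₁(b,b′)| ≤ θe^{−κ|b₋−b′₋|₁}` (`κ > 0`, bonds located on ℤ^ν with `≤ m` per site), then
`−½Re⟨Γ_σX, A⁻¹Γ_σX⟩ ≤ −½⟨Γ₀X, CΓ₀X⟩ + ½θ′‖X‖²`, `θ′ = θ·m(1+2/κ)^ν` — (2.21) for `R₁` by Schur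
(`B13Replacement223.hR1_of_WRS`). [cite: Balaban1988RG2Cluster, (2.16) p.16, (2.21) p.16] -/
theorem hR1_of_entrywise (Γσ : (N → ℝ) → (Λ → ℂ)) (Γ₀ : Matrix Λ N ℝ) (R₁ : Matrix N N ℝ) {θ κ : ℝ}
    (hθ : 0 ≤ θ) (hκ : 0 < κ) (loc : N → (Fin ν → ℤ)) {m : ℕ}
    (hfib : ∀ x : Fin ν → ℤ, (Finset.univ.filter fun j => loc j = x).card ≤ m)
    (hdef : ∀ X : N → ℝ, ((Γσ X) ⬝ᵥ (A⁻¹ *ᵥ Γσ X)).re = (Γ₀ *ᵥ X) ⬝ᵥ (C *ᵥ (Γ₀ *ᵥ X)) - X ⬝ᵥ (R₁ *ᵥ X))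
    (h216 : ∀ b b', ‖R₁ b b'‖ ≤ θ * Real.exp (-(κ * l1dist (loc b) (loc b')))) (X : N → ℝ) :
    -(1 / 2) * ((Γσ X) ⬝ᵥ (A⁻¹ *ᵥ Γσ X)).re
      ≤ -(1 / 2 * ((Γ₀ *ᵥ X) ⬝ᵥ (C *ᵥ (Γ₀ *ᵥ X)))) + θ * (m * (1 + 2 / κ) ^ ν) / 2 * (X ⬝ᵥ X) := by
  obtain ⟨h1, h1t⟩ := WRS_zero_of_entrywise hθ hκ loc hfib h216
  exact hR1_of_WRS (weightHyp_l1dist le_rfl loc) Γσ Γ₀ R₁ hdef h1 h1t X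

omit [Fintype Λ] [DecidableEq Λ] in
/-- A complex entrywise bound passes to the real part and to its negative; private plumbing. [folklore] -/
private theorem entrywise_re_neg {E : Matrix Λ Λ ℂ} {g : Λ → Λ → ℝ} (hE : ∀ i j, ‖E i j‖ ≤ g i j) :
    ∀ i j, ‖(-(E.map Complex.re)) i j‖ ≤ g i j := fun i j => by
  rw [Matrix.neg_apply, norm_neg, Matrix.map_apply, Real.norm_eq_abs]
  exact (Complex.abs_re_le_norm _).trans (hE i j)

/-- **`hR2` from (2.16) for `R₂`** (*"the next Gaussian measure is replaced by the measure with the new covariance …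
and by the function exp½⟨B, R₂B⟩ with R₂ satisfying (2.16)"*): writing `E = A − C⁻¹` for the difference between the
analytically continued precision `A = C^{(k)}(Z₀, σ(Z))⁻¹` and its `σ(Z) = 0`, `(U, 0)` value `C⁻¹`
(`R₂ = C⁻¹ − Re A = −Re E`), an entrywise bound `‖E(b,b′)‖ ≤ θe^{−κ|b₋−b′₋|₁}` gives `⟨B, R₂B⟩ ≤ θ′‖B‖²`,
`θ′ = θ·m(1+2/κ)^ν`. [cite: Balaban1988RG2Cluster, (2.16) p.16, (2.21) p.16] -/
theorem hR2_of_entrywise {θ κ : ℝ} (hθ : 0 ≤ θ) (hκ : 0 < κ) (loc : Λ → (Fin ν → ℤ)) {m : ℕ}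
    (hfib : ∀ x : Fin ν → ℤ, (Finset.univ.filter fun j => loc j = x).card ≤ m)
    (hE : ∀ b b', ‖(A - C⁻¹.map (algebraMap ℝ ℂ)) b b'‖ ≤ θ * Real.exp (-(κ * l1dist (loc b) (loc b'))))
    (B : Λ → ℝ) :
    B ⬝ᵥ ((C⁻¹ - A.map Complex.re) *ᵥ B) ≤ θ * (m * (1 + 2 / κ) ^ ν) * (B ⬝ᵥ B) := by
  have hRe : C⁻¹ - A.map Complex.re = -((A - C⁻¹.map (algebraMap ℝ ℂ)).map Complex.re) := by
    ext i j
    simp only [Matrix.sub_apply, Matrix.neg_apply, Matrix.map_apply, Complex.sub_re, Complex.coe_algebraMap,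
      Complex.ofReal_re]
    ring
  obtain ⟨h2, h2t⟩ := WRS_zero_of_entrywise hθ hκ loc hfib (entrywise_re_neg hE)
  rw [← hRe] at h2 h2t
  exact hR2_of_WRS (weightHyp_l1dist le_rfl loc) h2 h2t B

omit [DecidableEq Λ] [DecidableEq N] in
/-- **`hR3` from (2.16) for `R₃`** (*"In the second exponential the difference between the new bilinear form and the form
in (2.15) is a bilinear form −⟨B, R₃X⟩ with R₃ satisfying (2.16)"*): if `Re Γ_σX = (Γ₀ + R₃)X` with the RECTANGULAR
kernel `|R₃(b,b′)| ≤ θe^{−κ|b₋−b′₋|₁}` (rows = bonds of `Z₀`, columns = bonds of `Z`, both located on ℤ^ν with `≤ m` per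
site), then `−⟨B, Re Γ_σX⟩ ≤ −⟨B, Γ₀X⟩ + ½θ′(‖X‖² + ‖B‖²)`, `θ′ = θ·m(1+2/κ)^ν` — (2.21) for `R₃`
(`B13Replacement223.hR3_of_rowSum` + §1). [cite: Balaban1988RG2Cluster, (2.16) p.16, (2.21) p.16] -/
theorem hR3_of_entrywise (Γσ : (N → ℝ) → (Λ → ℂ)) (Γ₀ R₃ : Matrix Λ N ℝ) {θ κ : ℝ} (hθ : 0 ≤ θ) (hκ : 0 < κ)
    (locΛ : Λ → (Fin ν → ℤ)) (locN : N → (Fin ν → ℤ)) {m : ℕ}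
    (hfibΛ : ∀ x : Fin ν → ℤ, (Finset.univ.filter fun i => locΛ i = x).card ≤ m)
    (hfibN : ∀ x : Fin ν → ℤ, (Finset.univ.filter fun j => locN j = x).card ≤ m)
    (hdef : ∀ (X : N → ℝ) (i : Λ), (Γσ X i).re = ((Γ₀ + R₃) *ᵥ X) i)
    (h216 : ∀ i j, ‖R₃ i j‖ ≤ θ * Real.exp (-(κ * l1dist (locΛ i) (locN j)))) (X : N → ℝ) (B : Λ → ℝ) :
    -(B ⬝ᵥ fun i => (Γσ X i).re) ≤ -(B ⬝ᵥ (Γ₀ *ᵥ X)) + θ * (m * (1 + 2 / κ) ^ ν) / 2 * (X ⬝ᵥ X + B ⬝ᵥ B) := by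
  have hr : ∀ i, ∑ j, |R₃ i j| ≤ θ * (m * (1 + 2 / κ) ^ ν) := fun i => by
    simpa only [Real.norm_eq_abs] using rowSum_norm_le_of_entrywise hθ hκ locΛ locN hfibN h216 i
  have hc : ∀ j, ∑ i, |R₃ i j| ≤ θ * (m * (1 + 2 / κ) ^ ν) := fun j => by
    simpa only [Real.norm_eq_abs] using colSum_norm_le_of_entrywise hθ hκ locΛ locN hfibΛ h216 j
  exact hR3_of_rowSum Γσ Γ₀ R₃ hdef hr hc X B

/-- **The (2.17) factor of (2.15) from entrywise bounds** (*"The determinants in the next factor are equal for the new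
operators, hence this factor can be estimated by (2.17)"*): if the new covariance `C = C^{(k)}(Z₀, 0)` has the
entrywise decay `|C(b,b′)| ≤ K₀e^{−κ_C|b₋−b′₋|₁}` (the [15] propagator bound) and `E = A − C⁻¹` obeys (2.16) with
`(θ, κ)`, and `K′θ′ < 1` (`K′ = K₀·m(1+2/κ_C)^ν`, `θ′ = θ·m(1+2/κ)^ν`), then
`|det A/det Re A|^{1/2} ≤ exp(η|Λ|)`, `η = ½K′θ′(1 + (1 − K′θ′)⁻¹)` — the printed `exp((O(1)e^{−⅓δ₀M} + O(α₀+α₁))|Z₀|)`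
(`B13Replacement223.h17a_of_WRS`). [cite: Balaban1988RG2Cluster, (2.16)–(2.17) p.16] -/
theorem h17a_of_entrywise (hC : C.PosDef) (hA : (A.map Complex.re).PosDef) {θ κ K₀ κC : ℝ} (hθ : 0 ≤ θ)
    (hκ : 0 < κ) (hK₀ : 0 ≤ K₀) (hκC : 0 < κC) (loc : Λ → (Fin ν → ℤ)) {m : ℕ}
    (hfib : ∀ x : Fin ν → ℤ, (Finset.univ.filter fun j => loc j = x).card ≤ m)
    (hC216 : ∀ b b', ‖C b b'‖ ≤ K₀ * Real.exp (-(κC * l1dist (loc b) (loc b'))))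
    (hE : ∀ b b', ‖(A - C⁻¹.map (algebraMap ℝ ℂ)) b b'‖ ≤ θ * Real.exp (-(κ * l1dist (loc b) (loc b'))))
    (hsmall : K₀ * (m * (1 + 2 / κC) ^ ν) * (θ * (m * (1 + 2 / κ) ^ ν)) < 1) :
    Real.sqrt (‖A.det‖ / (A.map Complex.re).det)
      ≤ Real.exp (K₀ * (m * (1 + 2 / κC) ^ ν) * (θ * (m * (1 + 2 / κ) ^ ν))
          * (1 + (1 - K₀ * (m * (1 + 2 / κC) ^ ν) * (θ * (m * (1 + 2 / κ) ^ ν)))⁻¹) / 2 * Fintype.card Λ) :=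
  h17a_of_WRS (weightHyp_l1dist le_rfl loc) hC hA (WRS_zero_of_entrywise hK₀ hκC loc hfib hC216).1
    (WRS_zero_of_entrywise hθ hκ loc hfib hE).1 hsmall

/-- **The quotient of determinants of the measure change from entrywise bounds** (*"a quotient of determinants, which
can be estimated by (2.17)"*): under the hypotheses of `h17a_of_entrywise`,
`√(det Re A/det C⁻¹) ≤ exp(½K′θ′·|Λ|) ≤ exp(η|Λ|)` with the same `η` (`B13Replacement223.h17b_of_WRS`; `Re E` inherits
the entrywise bound). [cite: Balaban1988RG2Cluster, (2.17) p.16] -/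
theorem h17b_of_entrywise (hC : C.PosDef) (hA : (A.map Complex.re).PosDef) {θ κ K₀ κC : ℝ} (hθ : 0 ≤ θ)
    (hκ : 0 < κ) (hK₀ : 0 ≤ K₀) (hκC : 0 < κC) (loc : Λ → (Fin ν → ℤ)) {m : ℕ}
    (hfib : ∀ x : Fin ν → ℤ, (Finset.univ.filter fun j => loc j = x).card ≤ m)
    (hC216 : ∀ b b', ‖C b b'‖ ≤ K₀ * Real.exp (-(κC * l1dist (loc b) (loc b'))))
    (hE : ∀ b b', ‖(A - C⁻¹.map (algebraMap ℝ ℂ)) b b'‖ ≤ θ * Real.exp (-(κ * l1dist (loc b) (loc b'))))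
    (hsmall : K₀ * (m * (1 + 2 / κC) ^ ν) * (θ * (m * (1 + 2 / κ) ^ ν)) < 1) :
    Real.sqrt ((A.map Complex.re).det / C⁻¹.det)
      ≤ Real.exp (K₀ * (m * (1 + 2 / κC) ^ ν) * (θ * (m * (1 + 2 / κ) ^ ν))
          * (1 + (1 - K₀ * (m * (1 + 2 / κC) ^ ν) * (θ * (m * (1 + 2 / κ) ^ ν)))⁻¹) / 2 * Fintype.card Λ) := by
  have hRe : (A - C⁻¹.map (algebraMap ℝ ℂ)).map Complex.re = A.map Complex.re - C⁻¹ := by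
    ext i j
    simp only [Matrix.sub_apply, Matrix.map_apply, Complex.sub_re, Complex.coe_algebraMap, Complex.ofReal_re]
  have hE' : ∀ b b', ‖(A.map Complex.re - C⁻¹) b b'‖ ≤ θ * Real.exp (-(κ * l1dist (loc b) (loc b'))) :=
    fun b b' => by
      rw [← hRe, Matrix.map_apply, Real.norm_eq_abs]
      exact (Complex.abs_re_le_norm _).trans (hE b b')
  set K' : ℝ := K₀ * (m * (1 + 2 / κC) ^ ν) with hK'
  set θ' : ℝ := θ * (m * (1 + 2 / κ) ^ ν) with hθ'
  have h := h17b_of_WRS (weightHyp_l1dist le_rfl loc) hC hA (WRS_zero_of_entrywise hK₀ hκC loc hfib hC216).1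
    (WRS_zero_of_entrywise hθ hκ loc hfib hE').1 hsmall
  refine h.trans (Real.exp_le_exp.2 (mul_le_mul_of_nonneg_right ?_ (Nat.cast_nonneg _)))
  have hKθ0 : 0 ≤ K' * θ' := mul_nonneg (mul_nonneg hK₀ (by positivity)) (mul_nonneg hθ (by positivity))
  have hinv : 0 ≤ (1 - K' * θ')⁻¹ := inv_nonneg.2 (by linarith)
  rw [← hK', ← hθ'] at *
  nlinarith [mul_nonneg hKθ0 hinv]

end From216

/-! ## §3. (2.26) assembled with (2.16) entrywise -/

section Assembly

variable {ν : ℕ} {Λ : Type} [Fintype Λ] [DecidableEq Λ] {C₀ : Type} [Fintype C₀] [DecidableEq C₀]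
variable {ι κ : Type*}

/-- **The sup bound `K` of the last three lines of (2.14), with (2.16) ENTRYWISE** — `B13Bound226Assembly.norm_core214_F214_le_K`
with its five replacement hypotheses `hR1`, `hR2`, `hR3`, `h17a`, `h17b` replaced by: uniformly for the `σ` of the
σ-polydisc, the identities defining `R₁(σ)` (first quadratic form) and `R₃(σ)` (`Re Γ(σ) = Γ₀ + R₃(σ)`), the entrywise
(2.16) for `R₁(σ)`, `E(σ) = A(σ) − C⁻¹`, `R₃(σ)` with `(θ, κ)`; the entrywise decay `(K₀, κ_C)` of `C`; bonds of `Z₀`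
(`Λ`) and of `Z` (`Λ ⊕ C₀`) located on ℤ^ν with `≤ m` per site; `K′θ′ < 1`.  Conclusion: on the polydiscs
`‖∫dμ₀(X)|_Z (lines 2–4 of (2.14))(σ, τ)‖ ≤ e^{2η|Λ|}·exp(−½γ₂(ε₁²/g_k²)|P| + w)·e^{α₅c|Λ|}·e^{α₅(1+2cg)|N|}` with
`α₅ = 2θ′ + γ₂ + a`, `θ′ = θ·m(1+2/κ)^ν`, `η = ½K′θ′(1 + (1 − K′θ′)⁻¹)`, `K′ = K₀·m(1+2/κ_C)^ν`.
[cite: Balaban1988RG2Cluster, (2.15) p.15, (2.16)–(2.22) p.16, (2.23)–(2.26) p.17] -/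
theorem norm_core214_F214_le_K_of_216 (A : (ι → ℂ) → Matrix Λ Λ ℂ) (Γ : (ι → ℂ) → (Λ ⊕ C₀ → ℝ) → (Λ → ℂ))
    {C : Matrix Λ Λ ℝ} (hC : C.PosDef) (Γ₀ : Matrix Λ (Λ ⊕ C₀) ℝ) (Rσ : ι → ℝ) (Rτ : κ → ℝ)
    (hAs : ∀ σ : ι → ℂ, (∀ j, ‖σ j‖ ≤ Rσ j) → (A σ).IsSymm)
    (hA : ∀ σ : ι → ℂ, (∀ j, ‖σ j‖ ≤ Rσ j) → ((A σ).map Complex.re).PosDef)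
    (hΓc : ∀ σ : ι → ℂ, (∀ j, ‖σ j‖ ≤ Rσ j) → Continuous (Γ σ))
    (cardP : ℕ) (χY₀ χcP : (Λ → ℝ) → ℝ) (hχ0 : ∀ B, 0 ≤ χY₀ B) (hχc0 : ∀ B, 0 ≤ χcP B) (Dfam : Finset κ)
    (V : κ → (Λ → ℝ) → ℂ) {γ₂ r a w : ℝ} (qP : (Λ → ℝ) → ℝ)
    (h222 : ∀ B, χY₀ B * χcP B ≤ Real.exp (-(γ₂ / 2 * r ^ 2 * cardP) + γ₂ / 2 * qP B)) (hγ₂ : 0 ≤ γ₂)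
    (hqP : ∀ B, qP B ≤ B ⬝ᵥ B) (h220R : ∀ B, ∑ Y ∈ Dfam, Rτ Y * ‖V Y B‖ ≤ a / 2 * (B ⬝ᵥ B) + w) (ha0 : 0 ≤ a)
    -- the located bonds and the entrywise (2.16)
    {θ kap K₀ κC : ℝ} (hθ : 0 ≤ θ) (hkap : 0 < kap) (hK₀ : 0 ≤ K₀) (hκC : 0 < κC)
    (locΛ : Λ → (Fin ν → ℤ)) (locN : Λ ⊕ C₀ → (Fin ν → ℤ)) {m : ℕ}
    (hfibΛ : ∀ x : Fin ν → ℤ, (Finset.univ.filter fun i => locΛ i = x).card ≤ m)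
    (hfibN : ∀ x : Fin ν → ℤ, (Finset.univ.filter fun j => locN j = x).card ≤ m)
    (R₁ : (ι → ℂ) → Matrix (Λ ⊕ C₀) (Λ ⊕ C₀) ℝ) (R₃ : (ι → ℂ) → Matrix Λ (Λ ⊕ C₀) ℝ)
    (hdef1 : ∀ σ : ι → ℂ, (∀ j, ‖σ j‖ ≤ Rσ j) → ∀ X : Λ ⊕ C₀ → ℝ,
      ((Γ σ X) ⬝ᵥ ((A σ)⁻¹ *ᵥ Γ σ X)).re = (Γ₀ *ᵥ X) ⬝ᵥ (C *ᵥ (Γ₀ *ᵥ X)) - X ⬝ᵥ (R₁ σ *ᵥ X))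
    (h216R1 : ∀ σ : ι → ℂ, (∀ j, ‖σ j‖ ≤ Rσ j) →
      ∀ b b', ‖R₁ σ b b'‖ ≤ θ * Real.exp (-(kap * l1dist (locN b) (locN b'))))
    (h216E : ∀ σ : ι → ℂ, (∀ j, ‖σ j‖ ≤ Rσ j) →
      ∀ b b', ‖(A σ - C⁻¹.map (algebraMap ℝ ℂ)) b b'‖ ≤ θ * Real.exp (-(kap * l1dist (locΛ b) (locΛ b'))))
    (hdef3 : ∀ σ : ι → ℂ, (∀ j, ‖σ j‖ ≤ Rσ j) → ∀ (X : Λ ⊕ C₀ → ℝ) (i : Λ), (Γ σ X i).re = ((Γ₀ + R₃ σ) *ᵥ X) i)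
    (h216R3 : ∀ σ : ι → ℂ, (∀ j, ‖σ j‖ ≤ Rσ j) →
      ∀ i j, ‖R₃ σ i j‖ ≤ θ * Real.exp (-(kap * l1dist (locΛ i) (locN j))))
    (hC216 : ∀ b b', ‖C b b'‖ ≤ K₀ * Real.exp (-(κC * l1dist (locΛ b) (locΛ b'))))
    (hsmallKθ : K₀ * (m * (1 + 2 / κC) ^ ν) * (θ * (m * (1 + 2 / kap) ^ ν)) < 1)
    -- the (2.24)–(2.25) smallness
    {c g : ℝ} (hc0 : 0 ≤ c) (hc : ∀ k, hC.1.eigenvalues k ≤ c)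
    (hαc : (2 * (θ * (m * (1 + 2 / kap) ^ ν)) + (γ₂ + a)) * c ≤ 1 / 2) (hg : 0 ≤ g)
    (hΓ : ∀ X : Λ ⊕ C₀ → ℝ, (Γ₀ *ᵥ X) ⬝ᵥ (C *ᵥ (Γ₀ *ᵥ X)) ≤ g * (X ⬝ᵥ X))
    (hsmall : (2 * (θ * (m * (1 + 2 / kap) ^ ν)) + (γ₂ + a)) * (1 + 2 * c * g) ≤ 1 / 2) :
    ∀ (σ : ι → ℂ) (τ : κ → ℂ), (∀ j, ‖σ j‖ ≤ Rσ j) → (∀ Y, ‖τ Y‖ ≤ Rτ Y) →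
      ‖core214 A Γ (F214 cardP χY₀ χcP Dfam V) σ τ‖
        ≤ Real.exp (2 * (K₀ * (m * (1 + 2 / κC) ^ ν) * (θ * (m * (1 + 2 / kap) ^ ν))
              * (1 + (1 - K₀ * (m * (1 + 2 / κC) ^ ν) * (θ * (m * (1 + 2 / kap) ^ ν)))⁻¹) / 2) * Fintype.card Λ)
          * Real.exp (-(γ₂ / 2 * r ^ 2 * cardP) + w)
          * (Real.exp ((2 * (θ * (m * (1 + 2 / kap) ^ ν)) + (γ₂ + a)) * c * Fintype.card Λ)
            * Real.exp ((2 * (θ * (m * (1 + 2 / kap) ^ ν)) + (γ₂ + a)) * (1 + 2 * c * g)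
              * Fintype.card (Λ ⊕ C₀))) :=
  norm_core214_F214_le_K A Γ hC Γ₀ Rσ Rτ hAs hA hΓc cardP χY₀ χcP hχ0 hχc0 Dfam V qP h222 hγ₂ hqP h220R
    (ρ := θ * (m * (1 + 2 / kap) ^ ν)) (mul_nonneg hθ (by positivity)) ha0
    (fun σ hσ X => hR1_of_entrywise (Γ σ) Γ₀ (R₁ σ) hθ hkap locN hfibN (hdef1 σ hσ) (h216R1 σ hσ) X)
    (fun σ hσ => h17a_of_entrywise hC (hA σ hσ) hθ hkap hK₀ hκC locΛ hfibΛ hC216 (h216E σ hσ) hsmallKθ)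
    (fun σ hσ => h17b_of_entrywise hC (hA σ hσ) hθ hkap hK₀ hκC locΛ hfibΛ hC216 (h216E σ hσ) hsmallKθ)
    (fun σ hσ B => hR2_of_entrywise hθ hkap locΛ hfibΛ (h216E σ hσ) B)
    (fun σ hσ X B => hR3_of_entrywise (Γ σ) Γ₀ (R₃ σ) hθ hkap locΛ locN hfibΛ hfibN (hdef3 σ hσ) (h216R3 σ hσ) X B)
    hc0 hc hαc hg hΓ hsmall

variable [DecidableEq ι] [DecidableEq κ]

/-- **(2.26) assembled end to end for the typed term (2.14), with (2.16) ENTRYWISE** (*"Gathering together all the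
bounds we get"* (2.26)): `B13Bound226Assembly.norm_term214_le_226_assembled` — σ-radius `e^{κ₁}` (`κ₁ ≥ 1`), τ-radii
`R_τ(Y) ≥ 2`, separate analyticity in (σ, τ), base points in the unit polydiscs — with the replacement errors entered as
the printed entrywise (2.16) for `R₁(σ)`, `E(σ) = A(σ) − C⁻¹`, `R₃(σ)` uniformly on the σ-polydisc, the entrywise
decay of `C`, located bonds, and `K′θ′ < 1`:
`|(2.14)| ≤ exp(−(κ₁ − 1)|lZ|) · [Π_{Y∈𝐃} 2/R_τ(Y)] · e^{2η|Λ|} · exp(−½γ₂(ε₁²/g_k²)|P| + w) · e^{α₅c|Λ|} ·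
e^{α₅(1+2cg)|N|}`, `α₅ = 2θ′ + γ₂ + a`. [cite: Balaban1988RG2Cluster, (2.14)–(2.15) p.15, (2.16)–(2.22) p.16, (2.23)–(2.26) p.17] -/
theorem norm_term214_le_226_of_216 {κ₁ : ℝ} (hκ₁ : 1 ≤ κ₁) (Rτ : κ → ℝ) (hRτ : ∀ Y, 2 ≤ Rτ Y)
    {Uσ Uτ : Set ℂ} (hUσ : IsOpen Uσ) (hUτ : IsOpen Uτ) (hUexp : closedBall (0 : ℂ) (Real.exp κ₁) ⊆ Uσ)
    (hUtau : ∀ Y, closedBall (0 : ℂ) (Rτ Y) ⊆ Uτ) {r : ℝ} (hr : 0 < r) (hr' : r ≤ Real.exp κ₁ - 1)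
    (hsubτ : ∀ s ∈ Set.uIcc (0 : ℝ) 1, closedBall (s : ℂ) r ⊆ Uτ)
    (A : (ι → ℂ) → Matrix Λ Λ ℂ) (Γ : (ι → ℂ) → (Λ ⊕ C₀ → ℝ) → (Λ → ℂ))
    (cardP : ℕ) (χY₀ χcP : (Λ → ℝ) → ℝ) (hχ0 : ∀ B, 0 ≤ χY₀ B) (hχc0 : ∀ B, 0 ≤ χcP B) (Dfam : Finset κ)
    (V : κ → (Λ → ℝ) → ℂ)
    (hΨσ : ∀ τ : κ → ℂ, (∀ j, τ j ∈ Uτ) → SepHolOn Uσ (fun σ => core214 A Γ (F214 cardP χY₀ χcP Dfam V) σ τ))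
    (hΨτ : ∀ σ : ι → ℂ, (∀ j, σ j ∈ Uσ) → SepHolOn Uτ (fun τ => core214 A Γ (F214 cardP χY₀ χcP Dfam V) σ τ))
    {C : Matrix Λ Λ ℝ} (hC : C.PosDef) (Γ₀ : Matrix Λ (Λ ⊕ C₀) ℝ)
    (hAs : ∀ σ : ι → ℂ, (∀ j, ‖σ j‖ ≤ Real.exp κ₁) → (A σ).IsSymm)
    (hA : ∀ σ : ι → ℂ, (∀ j, ‖σ j‖ ≤ Real.exp κ₁) → ((A σ).map Complex.re).PosDef)
    (hΓc : ∀ σ : ι → ℂ, (∀ j, ‖σ j‖ ≤ Real.exp κ₁) → Continuous (Γ σ))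
    {γ₂ rP a w : ℝ} (qP : (Λ → ℝ) → ℝ)
    (h222 : ∀ B, χY₀ B * χcP B ≤ Real.exp (-(γ₂ / 2 * rP ^ 2 * cardP) + γ₂ / 2 * qP B)) (hγ₂ : 0 ≤ γ₂)
    (hqP : ∀ B, qP B ≤ B ⬝ᵥ B) (h220R : ∀ B, ∑ Y ∈ Dfam, Rτ Y * ‖V Y B‖ ≤ a / 2 * (B ⬝ᵥ B) + w) (ha0 : 0 ≤ a)
    {θ kap K₀ κC : ℝ} (hθ : 0 ≤ θ) (hkap : 0 < kap) (hK₀ : 0 ≤ K₀) (hκC : 0 < κC)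
    (locΛ : Λ → (Fin ν → ℤ)) (locN : Λ ⊕ C₀ → (Fin ν → ℤ)) {m : ℕ}
    (hfibΛ : ∀ x : Fin ν → ℤ, (Finset.univ.filter fun i => locΛ i = x).card ≤ m)
    (hfibN : ∀ x : Fin ν → ℤ, (Finset.univ.filter fun j => locN j = x).card ≤ m)
    (R₁ : (ι → ℂ) → Matrix (Λ ⊕ C₀) (Λ ⊕ C₀) ℝ) (R₃ : (ι → ℂ) → Matrix Λ (Λ ⊕ C₀) ℝ)
    (hdef1 : ∀ σ : ι → ℂ, (∀ j, ‖σ j‖ ≤ Real.exp κ₁) → ∀ X : Λ ⊕ C₀ → ℝ,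
      ((Γ σ X) ⬝ᵥ ((A σ)⁻¹ *ᵥ Γ σ X)).re = (Γ₀ *ᵥ X) ⬝ᵥ (C *ᵥ (Γ₀ *ᵥ X)) - X ⬝ᵥ (R₁ σ *ᵥ X))
    (h216R1 : ∀ σ : ι → ℂ, (∀ j, ‖σ j‖ ≤ Real.exp κ₁) →
      ∀ b b', ‖R₁ σ b b'‖ ≤ θ * Real.exp (-(kap * l1dist (locN b) (locN b'))))
    (h216E : ∀ σ : ι → ℂ, (∀ j, ‖σ j‖ ≤ Real.exp κ₁) →
      ∀ b b', ‖(A σ - C⁻¹.map (algebraMap ℝ ℂ)) b b'‖ ≤ θ * Real.exp (-(kap * l1dist (locΛ b) (locΛ b'))))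
    (hdef3 : ∀ σ : ι → ℂ, (∀ j, ‖σ j‖ ≤ Real.exp κ₁) →
      ∀ (X : Λ ⊕ C₀ → ℝ) (i : Λ), (Γ σ X i).re = ((Γ₀ + R₃ σ) *ᵥ X) i)
    (h216R3 : ∀ σ : ι → ℂ, (∀ j, ‖σ j‖ ≤ Real.exp κ₁) →
      ∀ i j, ‖R₃ σ i j‖ ≤ θ * Real.exp (-(kap * l1dist (locΛ i) (locN j))))
    (hC216 : ∀ b b', ‖C b b'‖ ≤ K₀ * Real.exp (-(κC * l1dist (locΛ b) (locΛ b'))))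
    (hsmallKθ : K₀ * (m * (1 + 2 / κC) ^ ν) * (θ * (m * (1 + 2 / kap) ^ ν)) < 1)
    {c g : ℝ} (hc0 : 0 ≤ c) (hc : ∀ k, hC.1.eigenvalues k ≤ c)
    (hαc : (2 * (θ * (m * (1 + 2 / kap) ^ ν)) + (γ₂ + a)) * c ≤ 1 / 2) (hg : 0 ≤ g)
    (hΓ : ∀ X : Λ ⊕ C₀ → ℝ, (Γ₀ *ᵥ X) ⬝ᵥ (C *ᵥ (Γ₀ *ᵥ X)) ≤ g * (X ⬝ᵥ X))
    (hsmall : (2 * (θ * (m * (1 + 2 / kap) ^ ν)) + (γ₂ + a)) * (1 + 2 * c * g) ≤ 1 / 2)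
    {lZ : List ι} (hlZ : lZ.Nodup) {lD : List κ} (hlD : lD.Nodup)
    {σ₀ : ι → ℂ} (hσ₀ : ∀ j, ‖σ₀ j‖ ≤ 1) {τ₀ : κ → ℂ} (hτ₀ : ∀ Y, ‖τ₀ Y‖ ≤ 1) :
    ‖term214 r lZ lD (core214 A Γ (F214 cardP χY₀ χcP Dfam V)) σ₀ τ₀‖ ≤
      Real.exp (-(κ₁ - 1) * lZ.length) * (∏ Y ∈ lD.toFinset, 2 * (Rτ Y)⁻¹)
        * (Real.exp (2 * (K₀ * (m * (1 + 2 / κC) ^ ν) * (θ * (m * (1 + 2 / kap) ^ ν))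
              * (1 + (1 - K₀ * (m * (1 + 2 / κC) ^ ν) * (θ * (m * (1 + 2 / kap) ^ ν)))⁻¹) / 2) * Fintype.card Λ)
          * Real.exp (-(γ₂ / 2 * rP ^ 2 * cardP) + w)
          * (Real.exp ((2 * (θ * (m * (1 + 2 / kap) ^ ν)) + (γ₂ + a)) * c * Fintype.card Λ)
            * Real.exp ((2 * (θ * (m * (1 + 2 / kap) ^ ν)) + (γ₂ + a)) * (1 + 2 * c * g)
              * Fintype.card (Λ ⊕ C₀)))) :=
  norm_term214_le_215 hκ₁ Rτ hRτ hUσ hUτ hUexp hUtau hr hr' hsubτ hΨσ hΨτ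
    (norm_core214_F214_le_K_of_216 A Γ hC Γ₀ (fun _ => Real.exp κ₁) Rτ hAs hA hΓc cardP χY₀ χcP hχ0 hχc0 Dfam V
      qP h222 hγ₂ hqP h220R ha0 hθ hkap hK₀ hκC locΛ locN hfibΛ hfibN R₁ R₃ hdef1 h216R1 h216E hdef3 h216R3 hC216
      hsmallKθ hc0 hc hαc hg hΓ hsmall)
    hlZ hlD hσ₀ hτ₀

/-- **(2.26) with the printed bracket at the τ-radii (2.18), (2.16) ENTRYWISE**: `B13Bound226Assembly.norm_term214_le_226_assembled_218`
(σ-radius `e^{κ₁}`, `κ₁ = cst.κ₁ ≥ 1`; `|τ(Y)| = (invTau cst (d_k Y))⁻¹`, `0 < invTau ≤ ½`; (2.20) at these `|τ(Y)|`) with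
the replacement errors as the printed entrywise (2.16) and the entrywise decay of `C`:
`|(2.14)| ≤ exp(−(κ₁ − 1)|lZ|) · [Π_{Y∈𝐃} 2·invTau cst (d_k Y)] · e^{2η|Λ|} · exp(−½γ₂(ε₁²/g_k²)|P| + w) · e^{α₅c|Λ|} ·
e^{α₅(1+2cg)|N|}`. [cite: Balaban1988RG2Cluster, (2.16) p.16, (2.18) p.16, (2.26) p.17] -/
theorem norm_term214_le_226_of_216_218 (cst : B13.Consts) (hκ₁ : 1 ≤ cst.κ₁) (dk : κ → ℝ)
    (hpos : ∀ Y, 0 < invTau cst (dk Y)) (h2 : ∀ Y, invTau cst (dk Y) ≤ 1 / 2)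
    {Uσ Uτ : Set ℂ} (hUσ : IsOpen Uσ) (hUτ : IsOpen Uτ) (hUexp : closedBall (0 : ℂ) (Real.exp cst.κ₁) ⊆ Uσ)
    (hUtau : ∀ Y, closedBall (0 : ℂ) ((invTau cst (dk Y))⁻¹) ⊆ Uτ) {r : ℝ} (hr : 0 < r)
    (hr' : r ≤ Real.exp cst.κ₁ - 1) (hsubτ : ∀ s ∈ Set.uIcc (0 : ℝ) 1, closedBall (s : ℂ) r ⊆ Uτ)
    (A : (ι → ℂ) → Matrix Λ Λ ℂ) (Γ : (ι → ℂ) → (Λ ⊕ C₀ → ℝ) → (Λ → ℂ))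
    (cardP : ℕ) (χY₀ χcP : (Λ → ℝ) → ℝ) (hχ0 : ∀ B, 0 ≤ χY₀ B) (hχc0 : ∀ B, 0 ≤ χcP B) (Dfam : Finset κ)
    (V : κ → (Λ → ℝ) → ℂ)
    (hΨσ : ∀ τ : κ → ℂ, (∀ j, τ j ∈ Uτ) → SepHolOn Uσ (fun σ => core214 A Γ (F214 cardP χY₀ χcP Dfam V) σ τ))
    (hΨτ : ∀ σ : ι → ℂ, (∀ j, σ j ∈ Uσ) → SepHolOn Uτ (fun τ => core214 A Γ (F214 cardP χY₀ χcP Dfam V) σ τ))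
    {C : Matrix Λ Λ ℝ} (hC : C.PosDef) (Γ₀ : Matrix Λ (Λ ⊕ C₀) ℝ)
    (hAs : ∀ σ : ι → ℂ, (∀ j, ‖σ j‖ ≤ Real.exp cst.κ₁) → (A σ).IsSymm)
    (hA : ∀ σ : ι → ℂ, (∀ j, ‖σ j‖ ≤ Real.exp cst.κ₁) → ((A σ).map Complex.re).PosDef)
    (hΓc : ∀ σ : ι → ℂ, (∀ j, ‖σ j‖ ≤ Real.exp cst.κ₁) → Continuous (Γ σ))
    {γ₂ rP a w : ℝ} (qP : (Λ → ℝ) → ℝ)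
    (h222 : ∀ B, χY₀ B * χcP B ≤ Real.exp (-(γ₂ / 2 * rP ^ 2 * cardP) + γ₂ / 2 * qP B)) (hγ₂ : 0 ≤ γ₂)
    (hqP : ∀ B, qP B ≤ B ⬝ᵥ B)
    (h220R : ∀ B, ∑ Y ∈ Dfam, (invTau cst (dk Y))⁻¹ * ‖V Y B‖ ≤ a / 2 * (B ⬝ᵥ B) + w) (ha0 : 0 ≤ a)
    {θ kap K₀ κC : ℝ} (hθ : 0 ≤ θ) (hkap : 0 < kap) (hK₀ : 0 ≤ K₀) (hκC : 0 < κC)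
    (locΛ : Λ → (Fin ν → ℤ)) (locN : Λ ⊕ C₀ → (Fin ν → ℤ)) {m : ℕ}
    (hfibΛ : ∀ x : Fin ν → ℤ, (Finset.univ.filter fun i => locΛ i = x).card ≤ m)
    (hfibN : ∀ x : Fin ν → ℤ, (Finset.univ.filter fun j => locN j = x).card ≤ m)
    (R₁ : (ι → ℂ) → Matrix (Λ ⊕ C₀) (Λ ⊕ C₀) ℝ) (R₃ : (ι → ℂ) → Matrix Λ (Λ ⊕ C₀) ℝ)
    (hdef1 : ∀ σ : ι → ℂ, (∀ j, ‖σ j‖ ≤ Real.exp cst.κ₁) → ∀ X : Λ ⊕ C₀ → ℝ,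
      ((Γ σ X) ⬝ᵥ ((A σ)⁻¹ *ᵥ Γ σ X)).re = (Γ₀ *ᵥ X) ⬝ᵥ (C *ᵥ (Γ₀ *ᵥ X)) - X ⬝ᵥ (R₁ σ *ᵥ X))
    (h216R1 : ∀ σ : ι → ℂ, (∀ j, ‖σ j‖ ≤ Real.exp cst.κ₁) →
      ∀ b b', ‖R₁ σ b b'‖ ≤ θ * Real.exp (-(kap * l1dist (locN b) (locN b'))))
    (h216E : ∀ σ : ι → ℂ, (∀ j, ‖σ j‖ ≤ Real.exp cst.κ₁) →
      ∀ b b', ‖(A σ - C⁻¹.map (algebraMap ℝ ℂ)) b b'‖ ≤ θ * Real.exp (-(kap * l1dist (locΛ b) (locΛ b'))))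
    (hdef3 : ∀ σ : ι → ℂ, (∀ j, ‖σ j‖ ≤ Real.exp cst.κ₁) →
      ∀ (X : Λ ⊕ C₀ → ℝ) (i : Λ), (Γ σ X i).re = ((Γ₀ + R₃ σ) *ᵥ X) i)
    (h216R3 : ∀ σ : ι → ℂ, (∀ j, ‖σ j‖ ≤ Real.exp cst.κ₁) →
      ∀ i j, ‖R₃ σ i j‖ ≤ θ * Real.exp (-(kap * l1dist (locΛ i) (locN j))))
    (hC216 : ∀ b b', ‖C b b'‖ ≤ K₀ * Real.exp (-(κC * l1dist (locΛ b) (locΛ b'))))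
    (hsmallKθ : K₀ * (m * (1 + 2 / κC) ^ ν) * (θ * (m * (1 + 2 / kap) ^ ν)) < 1)
    {c g : ℝ} (hc0 : 0 ≤ c) (hc : ∀ k, hC.1.eigenvalues k ≤ c)
    (hαc : (2 * (θ * (m * (1 + 2 / kap) ^ ν)) + (γ₂ + a)) * c ≤ 1 / 2) (hg : 0 ≤ g)
    (hΓ : ∀ X : Λ ⊕ C₀ → ℝ, (Γ₀ *ᵥ X) ⬝ᵥ (C *ᵥ (Γ₀ *ᵥ X)) ≤ g * (X ⬝ᵥ X))
    (hsmall : (2 * (θ * (m * (1 + 2 / kap) ^ ν)) + (γ₂ + a)) * (1 + 2 * c * g) ≤ 1 / 2)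
    {lZ : List ι} (hlZ : lZ.Nodup) {lD : List κ} (hlD : lD.Nodup)
    {σ₀ : ι → ℂ} (hσ₀ : ∀ j, ‖σ₀ j‖ ≤ 1) {τ₀ : κ → ℂ} (hτ₀ : ∀ Y, ‖τ₀ Y‖ ≤ 1) :
    ‖term214 r lZ lD (core214 A Γ (F214 cardP χY₀ χcP Dfam V)) σ₀ τ₀‖ ≤
      Real.exp (-(cst.κ₁ - 1) * lZ.length) * (∏ Y ∈ lD.toFinset, 2 * invTau cst (dk Y))
        * (Real.exp (2 * (K₀ * (m * (1 + 2 / κC) ^ ν) * (θ * (m * (1 + 2 / kap) ^ ν))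
              * (1 + (1 - K₀ * (m * (1 + 2 / κC) ^ ν) * (θ * (m * (1 + 2 / kap) ^ ν)))⁻¹) / 2) * Fintype.card Λ)
          * Real.exp (-(γ₂ / 2 * rP ^ 2 * cardP) + w)
          * (Real.exp ((2 * (θ * (m * (1 + 2 / kap) ^ ν)) + (γ₂ + a)) * c * Fintype.card Λ)
            * Real.exp ((2 * (θ * (m * (1 + 2 / kap) ^ ν)) + (γ₂ + a)) * (1 + 2 * c * g)
              * Fintype.card (Λ ⊕ C₀)))) :=
  norm_term214_le_226 cst hκ₁ dk hUσ hUτ hUexp hUtau hr hr' hsubτ hΨσ hΨτ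
    (norm_core214_F214_le_K_of_216 A Γ hC Γ₀ (fun _ => Real.exp cst.κ₁) (fun Y => (invTau cst (dk Y))⁻¹) hAs hA
      hΓc cardP χY₀ χcP hχ0 hχc0 Dfam V qP h222 hγ₂ hqP h220R ha0 hθ hkap hK₀ hκC locΛ locN hfibΛ hfibN R₁ R₃
      hdef1 h216R1 h216E hdef3 h216R3 hC216 hsmallKθ hc0 hc hαc hg hΓ hsmall)
    hlZ hlD hpos h2 hσ₀ hτ₀

omit [DecidableEq ι] [DecidableEq κ] in
/-- **The window/torus-joiner shape of the sup bound, (2.16) ENTRYWISE**: `B13Bound226Assembly.norm_core214_F214_le_window_shape`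
— when `|Λ| ≤ k_Λn`, `|N| ≤ k_Nn`, `w ≤ k_wn` (`n` = the number of LM-cubes of `Z`), on the two closed polydiscs
`‖∫dμ₀(X)|_Z (lines 2–4 of (2.14))(σ, τ)‖ ≤ exp(−½(γ₂r²)|P|)·exp(a₅·n)`,
`a₅ = 2ηk_Λ + k_w + α₅ck_Λ + α₅(1+2cg)k_N`, `α₅ = 2θ′ + γ₂ + a`, `η = ½K′θ′(1 + (1 − K′θ′)⁻¹)` — the hypothesis `hK`
of `B13Lemma3WindowCauchy.h226_of_cauchy`, from the printed entrywise (2.16) and the entrywise decay of `C`.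
[cite: Balaban1988RG2Cluster, (2.15) p.15, (2.16) p.16, (2.26) p.17] -/
theorem norm_core214_F214_le_window_shape_of_216 (A : (ι → ℂ) → Matrix Λ Λ ℂ)
    (Γ : (ι → ℂ) → (Λ ⊕ C₀ → ℝ) → (Λ → ℂ)) {C : Matrix Λ Λ ℝ} (hC : C.PosDef) (Γ₀ : Matrix Λ (Λ ⊕ C₀) ℝ)
    (Rσ : ι → ℝ) (Rτ : κ → ℝ)
    (hAs : ∀ σ : ι → ℂ, (∀ j, ‖σ j‖ ≤ Rσ j) → (A σ).IsSymm)
    (hA : ∀ σ : ι → ℂ, (∀ j, ‖σ j‖ ≤ Rσ j) → ((A σ).map Complex.re).PosDef)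
    (hΓc : ∀ σ : ι → ℂ, (∀ j, ‖σ j‖ ≤ Rσ j) → Continuous (Γ σ))
    (cardP : ℕ) (χY₀ χcP : (Λ → ℝ) → ℝ) (hχ0 : ∀ B, 0 ≤ χY₀ B) (hχc0 : ∀ B, 0 ≤ χcP B) (Dfam : Finset κ)
    (V : κ → (Λ → ℝ) → ℂ) {γ₂ rP a w : ℝ} (qP : (Λ → ℝ) → ℝ)
    (h222 : ∀ B, χY₀ B * χcP B ≤ Real.exp (-(γ₂ / 2 * rP ^ 2 * cardP) + γ₂ / 2 * qP B)) (hγ₂ : 0 ≤ γ₂)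
    (hqP : ∀ B, qP B ≤ B ⬝ᵥ B) (h220R : ∀ B, ∑ Y ∈ Dfam, Rτ Y * ‖V Y B‖ ≤ a / 2 * (B ⬝ᵥ B) + w) (ha0 : 0 ≤ a)
    {θ kap K₀ κC : ℝ} (hθ : 0 ≤ θ) (hkap : 0 < kap) (hK₀ : 0 ≤ K₀) (hκC : 0 < κC)
    (locΛ : Λ → (Fin ν → ℤ)) (locN : Λ ⊕ C₀ → (Fin ν → ℤ)) {m : ℕ}
    (hfibΛ : ∀ x : Fin ν → ℤ, (Finset.univ.filter fun i => locΛ i = x).card ≤ m)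
    (hfibN : ∀ x : Fin ν → ℤ, (Finset.univ.filter fun j => locN j = x).card ≤ m)
    (R₁ : (ι → ℂ) → Matrix (Λ ⊕ C₀) (Λ ⊕ C₀) ℝ) (R₃ : (ι → ℂ) → Matrix Λ (Λ ⊕ C₀) ℝ)
    (hdef1 : ∀ σ : ι → ℂ, (∀ j, ‖σ j‖ ≤ Rσ j) → ∀ X : Λ ⊕ C₀ → ℝ,
      ((Γ σ X) ⬝ᵥ ((A σ)⁻¹ *ᵥ Γ σ X)).re = (Γ₀ *ᵥ X) ⬝ᵥ (C *ᵥ (Γ₀ *ᵥ X)) - X ⬝ᵥ (R₁ σ *ᵥ X))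
    (h216R1 : ∀ σ : ι → ℂ, (∀ j, ‖σ j‖ ≤ Rσ j) →
      ∀ b b', ‖R₁ σ b b'‖ ≤ θ * Real.exp (-(kap * l1dist (locN b) (locN b'))))
    (h216E : ∀ σ : ι → ℂ, (∀ j, ‖σ j‖ ≤ Rσ j) →
      ∀ b b', ‖(A σ - C⁻¹.map (algebraMap ℝ ℂ)) b b'‖ ≤ θ * Real.exp (-(kap * l1dist (locΛ b) (locΛ b'))))
    (hdef3 : ∀ σ : ι → ℂ, (∀ j, ‖σ j‖ ≤ Rσ j) → ∀ (X : Λ ⊕ C₀ → ℝ) (i : Λ), (Γ σ X i).re = ((Γ₀ + R₃ σ) *ᵥ X) i)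
    (h216R3 : ∀ σ : ι → ℂ, (∀ j, ‖σ j‖ ≤ Rσ j) →
      ∀ i j, ‖R₃ σ i j‖ ≤ θ * Real.exp (-(kap * l1dist (locΛ i) (locN j))))
    (hC216 : ∀ b b', ‖C b b'‖ ≤ K₀ * Real.exp (-(κC * l1dist (locΛ b) (locΛ b'))))
    (hsmallKθ : K₀ * (m * (1 + 2 / κC) ^ ν) * (θ * (m * (1 + 2 / kap) ^ ν)) < 1)
    {c g : ℝ} (hc0 : 0 ≤ c) (hc : ∀ k, hC.1.eigenvalues k ≤ c)
    (hαc : (2 * (θ * (m * (1 + 2 / kap) ^ ν)) + (γ₂ + a)) * c ≤ 1 / 2) (hg : 0 ≤ g)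
    (hΓ : ∀ X : Λ ⊕ C₀ → ℝ, (Γ₀ *ᵥ X) ⬝ᵥ (C *ᵥ (Γ₀ *ᵥ X)) ≤ g * (X ⬝ᵥ X))
    (hsmall : (2 * (θ * (m * (1 + 2 / kap) ^ ν)) + (γ₂ + a)) * (1 + 2 * c * g) ≤ 1 / 2)
    {n kΛ kN kw : ℝ} (hΛ : (Fintype.card Λ : ℝ) ≤ kΛ * n) (hN : (Fintype.card (Λ ⊕ C₀) : ℝ) ≤ kN * n)
    (hw : w ≤ kw * n) :
    ∀ (σ : ι → ℂ) (τ : κ → ℂ), (∀ j, ‖σ j‖ ≤ Rσ j) → (∀ Y, ‖τ Y‖ ≤ Rτ Y) →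
      ‖core214 A Γ (F214 cardP χY₀ χcP Dfam V) σ τ‖
        ≤ Real.exp (-(γ₂ * rP ^ 2 / 2 * cardP))
          * Real.exp ((2 * (K₀ * (m * (1 + 2 / κC) ^ ν) * (θ * (m * (1 + 2 / kap) ^ ν))
                * (1 + (1 - K₀ * (m * (1 + 2 / κC) ^ ν) * (θ * (m * (1 + 2 / kap) ^ ν)))⁻¹) / 2) * kΛ + kw
              + (2 * (θ * (m * (1 + 2 / kap) ^ ν)) + (γ₂ + a)) * c * kΛ
              + (2 * (θ * (m * (1 + 2 / kap) ^ ν)) + (γ₂ + a)) * (1 + 2 * c * g) * kN) * n) := by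
  intro σ τ hσ hτ
  have hKθ0 : 0 ≤ K₀ * (m * (1 + 2 / κC) ^ ν) * (θ * (m * (1 + 2 / kap) ^ ν)) :=
    mul_nonneg (mul_nonneg hK₀ (by positivity)) (mul_nonneg hθ (by positivity))
  have hη0 : 0 ≤ K₀ * (m * (1 + 2 / κC) ^ ν) * (θ * (m * (1 + 2 / kap) ^ ν))
      * (1 + (1 - K₀ * (m * (1 + 2 / κC) ^ ν) * (θ * (m * (1 + 2 / kap) ^ ν)))⁻¹) / 2 :=
    div_nonneg (mul_nonneg hKθ0 (add_nonneg zero_le_one (inv_nonneg.2 (by linarith)))) zero_le_two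
  have hρ0 : 0 ≤ θ * (m * (1 + 2 / kap) ^ ν) := mul_nonneg hθ (by positivity)
  exact (norm_core214_F214_le_K_of_216 A Γ hC Γ₀ Rσ Rτ hAs hA hΓc cardP χY₀ χcP hχ0 hχc0 Dfam V qP h222 hγ₂ hqP
      h220R ha0 hθ hkap hK₀ hκC locΛ locN hfibΛ hfibN R₁ R₃ hdef1 h216R1 h216E hdef3 h216R3 hC216 hsmallKθ hc0 hc
      hαc hg hΓ hsmall σ τ hσ hτ).trans
    (K_le_window_shape hη0 (by linarith) hc0 hg hΛ hN hw)

end Assembly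

end Literature.MathematicalPhysics.QuantumFieldTheory.Balaban1983to89.B13Bound226From216

end
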